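import Summits.Ventures.PackingBounds.Configurations.Leech
import Summits.Ventures.PackingBounds.Configurations.SubspaceTransfer
import Summits.Ventures.PackingBounds.SphericalCodes.Dim23N4600

/-!
# The `4600` Leech neighbours: `A(23, arccos 1/3) = 4600` in Lean (attained side from the Leech lattice)

Framing: lottery ticket; floor = certified bounds/negative ranges. Venture `PackingBounds` (cell
`pub-packcert`, seat `pub-packcert-energy`).

Fix the Leech minimal vector `x₀ = (4, 4, 0²²)` (`√8`-scaling). Its neighbours at `60°` — the minimal
vectors `y` with `x₀ · y = 16` — are counted structurally: `88` of shape `A`, `77 · 32 = 2464` of shape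
`B` (octads through the two coordinates, both signs `+`) and `2 · 1024 = 2048` of shape `C`, total `4600`
(`card_nbr`). The vectors `2y - x₀` have norm `96`, are orthogonal to `x₀`, and two distinct ones have
inner product `4 y·y' - 32 ≤ 32`; normalised and moved into `x₀^⊥ ≅ ℝ²³` (`SubspaceTransfer`) they form
`4600` unit vectors with pairwise inner products `≤ 1/3`. With the cell's sharp Delsarte certificate
`SphericalCodes.code_dim23_le_4600` this gives **`A(23, arccos 1/3) = 4600`** as an `IsGreatest` theorem —
the kissing configuration of the Leech lattice's "equatorial" slice (Cohn–Kumar Table 1, row `(23, 4600)`).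

## References
* J. H. Conway, N. J. A. Sloane, *Sphere Packings, Lattices and Groups*, Ch. 4 §11, Ch. 14. [`ConwaySloane1999`]
* H. Cohn, A. Kumar, J. Amer. Math. Soc. 20 (2007) 99–148, Table 1. [`CohnKumar2006`]
-/

namespace Summit.Ventures.PackingBounds.Config.Leech

open Finset Golay

/-- The reference minimal vector `x₀ = (4, 4, 0, …, 0)`. -/
def x0 : Fin 24 → ℤ := avec 0 1 false false

/-- The `60°`-neighbours of `x₀` among the Leech minimal vectors. -/
noncomputable def nbr : Finset (Fin 24 → ℤ) := leechInt.filter fun y => ip x0 y = 16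

/-- Testing against `x₀`. -/
theorem ip_x0 (y : Fin 24 → ℤ) : ip x0 y = 4 * y 0 + 4 * y 1 := by
  rw [x0, ip_comm, ip_avec]; simp

/-- `x₀ · x₀ = 32`. -/
theorem ip_x0_x0 : ip x0 x0 = 32 := ip_avec_self (by decide) false false

/-! ### Counting the neighbours: shape `C` -/

/-- The low `12` bits of a codeword are the message bits (systematic encoding). -/
theorem testBit_cw_low {u : ℕ} (hu : u < 4096) {j : ℕ} (hj : j < 12) : (cw u).testBit j = u.testBit j := by
  have h : (cw u % 4096).testBit j = u.testBit j := by rw [(cw_sys u hu).1]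
  rw [show (4096 : ℕ) = 2 ^ 12 by norm_num, Nat.testBit_mod_two_pow] at h
  simp only [hj, decide_true, Bool.true_and] at h
  exact h

/-- Which shape-`C` vectors are neighbours of `x₀`. -/
theorem cvec_nbr_iff (i : Fin 24) {u : ℕ} (hu : u < 4096) :
    ip x0 (cvec i u) = 16 ↔
      (i = 0 ∧ u.testBit 0 = true ∧ u.testBit 1 = false) ∨ (i = 1 ∧ u.testBit 0 = false ∧ u.testBit 1 = true) := by
  rw [ip_x0]
  simp only [cvec, Fin.val_zero, Fin.val_one, testBit_cw_low hu (show 0 < 12 by norm_num),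
    testBit_cw_low hu (show 1 < 12 by norm_num)]
  by_cases hi0 : i = 0
  · subst hi0
    cases u.testBit 0 <;> cases u.testBit 1 <;> simp
  · by_cases hi1 : i = 1
    · subst hi1
      cases u.testBit 0 <;> cases u.testBit 1 <;> simp
    · simp only [Ne.symm hi0, Ne.symm hi1, if_false, mul_one, hi0, hi1, false_and, or_self, iff_false]
      cases u.testBit 0 <;> cases u.testBit 1 <;> simp

set_option maxRecDepth 100000 in
/-- `2048` shape-`C` neighbours. -/
theorem card_nbrC : ((univ ×ˢ range 4096).filter fun p : Fin 24 × ℕ => ip x0 (cvec p.1 p.2) = 16).card = 2048 := by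
  rw [Finset.filter_congr (q := fun p : Fin 24 × ℕ =>
      (p.1 = 0 ∧ p.2.testBit 0 = true ∧ p.2.testBit 1 = false) ∨ (p.1 = 1 ∧ p.2.testBit 0 = false ∧ p.2.testBit 1 = true))
      (fun p hp => cvec_nbr_iff p.1 (by simpa using hp))]
  decide +kernel

/-! ### Counting the neighbours: shape `B` -/

/-- In an octad containing the coordinate `0`, it is the first octad position. -/
theorem opos_symm_zero (o : Fin 759) (h0 : (0 : Fin 24) ∈ osupp o) : (opos o).symm ⟨0, h0⟩ = 0 := by
  by_contra hne
  have hlt : (0 : Fin 8) < (opos o).symm ⟨0, h0⟩ := Fin.pos_of_ne_zero hne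
  have h := (opos o).strictMono hlt
  rw [OrderIso.apply_symm_apply] at h
  exact absurd (show ((opos o 0 : osupp o) : Fin 24) < 0 from h) (Fin.not_lt_zero _)

/-- In an octad containing the coordinates `0` and `1`, `1` is the second octad position. -/
theorem opos_symm_one (o : Fin 759) (h0 : (0 : Fin 24) ∈ osupp o) (h1 : (1 : Fin 24) ∈ osupp o) :
    (opos o).symm ⟨1, h1⟩ = 1 := by
  have hz := opos_symm_zero o h0
  set r := (opos o).symm ⟨1, h1⟩ with hr
  have hr0 : r ≠ 0 := by
    intro h
    have := congrArg (opos o) h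
    rw [hr, OrderIso.apply_symm_apply, ← hz, OrderIso.apply_symm_apply] at this
    exact absurd (Subtype.mk.inj this) (by decide)
  have hr2 : ¬ (1 : Fin 8) < r := by
    intro hlt
    have h01 : (0 : Fin 8) < 1 := by decide
    have ha := (opos o).strictMono h01
    have hb := (opos o).strictMono hlt
    rw [hr, OrderIso.apply_symm_apply] at hb
    rw [← hz, OrderIso.apply_symm_apply] at ha
    have ha' : (0 : Fin 24) < ((opos o 1 : osupp o) : Fin 24) := ha
    have hb' : ((opos o 1 : osupp o) : Fin 24) < 1 := hb
    omega
  omega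

/-- Which shape-`B` vectors are neighbours of `x₀`. -/
theorem bvec_nbr_iff (o : Fin 759) (v : ℕ) :
    ip x0 (bvec o v) = 16 ↔
      ((0 : Fin 24) ∈ osupp o ∧ (1 : Fin 24) ∈ osupp o) ∧ (v.testBit 0 = false ∧ v.testBit 1 = false) := by
  rw [ip_x0]
  constructor
  · intro h
    rcases bvec_apply_cases o v 0 with ⟨h0, e0⟩ | ⟨h0, e0 | e0⟩ <;>
      rcases bvec_apply_cases o v 1 with ⟨h1', e1⟩ | ⟨h1', e1 | e1⟩ <;> (try omega)
    refine ⟨⟨h0, h1'⟩, ?_, ?_⟩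
    · have e := e0
      simp only [bvec, dif_pos h0, opos_symm_zero o h0] at e
      simpa [bbit] using (show bbit v 0 = false by
        rcases Bool.eq_false_or_eq_true (bbit v 0) with hb | hb <;> simp_all)
    · have e := e1
      simp only [bvec, dif_pos h1', opos_symm_one o h0 h1'] at e
      simpa [bbit] using (show bbit v 1 = false by
        rcases Bool.eq_false_or_eq_true (bbit v 1) with hb | hb <;> simp_all)
  · rintro ⟨⟨h0, h1'⟩, hv0, hv1⟩
    have hb0 : bbit v 0 = false := by simpa [bbit] using hv0
    have hb1 : bbit v 1 = false := by simpa [bbit] using hv1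
    simp only [bvec, dif_pos h0, dif_pos h1', opos_symm_zero o h0, opos_symm_one o h0 h1', hb0, hb1, sgn_false]
    norm_num

set_option maxRecDepth 100000 in
/-- `77` octads contain the coordinates `0` and `1`. -/
theorem card_octads_01 : (univ.filter fun o : Fin 759 => (0 : Fin 24) ∈ osupp o ∧ (1 : Fin 24) ∈ osupp o).card = 77 := by
  decide +kernel

set_option maxRecDepth 100000 in
/-- `32` sign patterns are `+` at the first two octad positions. -/
theorem card_patterns_00 : ((range 128).filter fun v => v.testBit 0 = false ∧ v.testBit 1 = false).card = 32 := by
  decide +kernel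

/-- `2464` shape-`B` neighbours. -/
theorem card_nbrB : ((univ ×ˢ range 128).filter fun p : Fin 759 × ℕ => ip x0 (bvec p.1 p.2) = 16).card = 2464 := by
  rw [Finset.filter_congr (q := fun p : Fin 759 × ℕ =>
      ((0 : Fin 24) ∈ osupp p.1 ∧ (1 : Fin 24) ∈ osupp p.1) ∧ (p.2.testBit 0 = false ∧ p.2.testBit 1 = false))
      (fun p _ => bvec_nbr_iff p.1 p.2),
    Finset.filter_product (fun o : Fin 759 => (0 : Fin 24) ∈ osupp o ∧ (1 : Fin 24) ∈ osupp o)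
      (fun v : ℕ => v.testBit 0 = false ∧ v.testBit 1 = false),
    card_product, card_octads_01, card_patterns_00]

/-! ### Counting the neighbours: shape `A`, and the total -/

set_option maxRecDepth 100000 in
/-- `88` shape-`A` neighbours. -/
theorem card_nbrA : (idxA.filter fun p => ip x0 (avec p.1.1 p.1.2 p.2.1 p.2.2) = 16).card = 88 := by
  rw [idxA]
  decide +kernel

/-- Shape-`A` neighbours of `x₀`, counted. -/
theorem card_nbr_setA : (setA.filter fun y => ip x0 y = 16).card = 88 := by
  rw [setA, filter_image, card_image_of_injOn, card_nbrA]
  rintro ⟨⟨k, l⟩, ⟨a, b⟩⟩ hp ⟨⟨k', l'⟩, ⟨a', b'⟩⟩ hp' h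
  have hkl : k < l := by have := (mem_filter.mp hp).1; simpa [idxA] using this
  have hkl' : k' < l' := by have := (mem_filter.mp hp').1; simpa [idxA] using this
  obtain ⟨e1, e2, e3, e4⟩ := avec_inj hkl hkl' h
  subst e1 e2 e3 e4; rfl

/-- Shape-`B` neighbours of `x₀`, counted. -/
theorem card_nbr_setB : (setB.filter fun y => ip x0 y = 16).card = 2464 := by
  rw [setB, filter_image, card_image_of_injOn, idxB, card_nbrB]
  rintro ⟨o, v⟩ hp ⟨o', v'⟩ hp' h
  have hv : v < 128 := by have := (mem_filter.mp hp).1; simpa [idxB] using this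
  have hv' : v' < 128 := by have := (mem_filter.mp hp').1; simpa [idxB] using this
  obtain ⟨e1, e2⟩ := bvec_inj hv hv' h
  subst e1 e2; rfl

/-- Shape-`C` neighbours of `x₀`, counted. -/
theorem card_nbr_setC : (setC.filter fun y => ip x0 y = 16).card = 2048 := by
  rw [setC, filter_image, card_image_of_injOn, idxC, card_nbrC]
  rintro ⟨i, u⟩ hp ⟨i', u'⟩ hp' h
  have hu : u < 4096 := by have := (mem_filter.mp hp).1; simpa [idxC] using this
  have hu' : u' < 4096 := by have := (mem_filter.mp hp').1; simpa [idxC] using this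
  obtain ⟨e1, e2⟩ := cvec_inj hu hu' h
  subst e1 e2; rfl

/-- **`x₀` has exactly `4600` neighbours at `60°`.** [cite: ConwaySloane1999, Ch. 4 §11 Table 4.13] -/
theorem card_nbr : nbr.card = 4600 := by
  rw [nbr, leechInt, filter_union, filter_union, card_union_eq_card_add_card.mpr, card_union_eq_card_add_card.mpr,
    card_nbr_setA, card_nbr_setB, card_nbr_setC]
  · exact disjoint_setA_setB.mono (filter_subset _ _) (filter_subset _ _)
  · rw [← filter_union]
    refine Disjoint.mono (filter_subset _ _) (filter_subset _ _) ?_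
    exact disjoint_union_left.mpr ⟨disjoint_setA_setC, disjoint_setB_setC⟩

/-! ### The projected configuration -/

/-- `2y - x₀`: twice the projection of a neighbour `y` to `x₀^⊥` (integer coordinates, norm `96`). -/
def proj (y : Fin 24 → ℤ) : Fin 24 → ℤ := fun j => 2 * y j - x0 j

/-- Inner products of projected vectors. -/
theorem ip_proj (y y' : Fin 24 → ℤ) : ip (proj y) (proj y') = 4 * ip y y' - 2 * ip x0 y - 2 * ip x0 y' + ip x0 x0 := by
  simp only [ip, proj]
  have : ∀ j, (2 * y j - x0 j) * (2 * y' j - x0 j) =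
      4 * (y j * y' j) - 2 * (x0 j * y j) - 2 * (x0 j * y' j) + x0 j * x0 j := fun j => by ring
  simp only [this, sum_add_distrib, sum_sub_distrib, ← mul_sum]

/-- Projected vectors are orthogonal to `x₀`. -/
theorem ip_x0_proj (y : Fin 24 → ℤ) : ip x0 (proj y) = 2 * ip x0 y - ip x0 x0 := by
  simp only [ip, proj]
  have : ∀ j, x0 j * (2 * y j - x0 j) = 2 * (x0 j * y j) - x0 j * x0 j := fun j => by ring
  simp only [this, sum_sub_distrib, ← mul_sum]

/-- `proj` is injective. -/
theorem proj_injective : Function.Injective proj := by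
  intro y y' h; funext j; have := congrFun h j; simp only [proj] at this; omega

/-- Members of `nbr`. -/
theorem mem_nbr {y : Fin 24 → ℤ} (hy : y ∈ nbr) : y ∈ leechInt ∧ ip x0 y = 16 := by
  simpa [nbr] using hy

/-- The `4600` projected, normalised neighbours (in `ℝ²⁴`, all orthogonal to `x₀`). -/
noncomputable def pre4600 : Finset (EuclideanSpace ℝ (Fin 24)) := nbr.image fun y => toE 96 (proj y)

/-- `|pre4600| = 4600`. -/
theorem card_pre4600 : pre4600.card = 4600 := by
  rw [pre4600, card_image_of_injOn (fun y _ y' _ h => proj_injective (toE_injective (by norm_num) h)), card_nbr]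

/-- The projected neighbours are unit vectors. -/
theorem norm_pre4600 : ∀ x ∈ pre4600, ‖x‖ = 1 := by
  intro x hx
  obtain ⟨y, hy, rfl⟩ := mem_image.mp hx
  obtain ⟨hyL, hy16⟩ := mem_nbr hy
  refine norm_toE (by norm_num) ?_
  rw [ip_proj, ip_self_of_mem hyL, hy16, ip_x0_x0]; norm_num

/-- Distinct projected neighbours have inner product `≤ 1/3`. -/
theorem inner_pre4600 : ∀ x ∈ pre4600, ∀ x' ∈ pre4600, x ≠ x' → inner ℝ x x' ≤ 1 / 3 := by
  intro x hx x' hx' hne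
  obtain ⟨y, hy, rfl⟩ := mem_image.mp hx
  obtain ⟨y', hy', rfl⟩ := mem_image.mp hx'
  obtain ⟨hyL, hy16⟩ := mem_nbr hy
  obtain ⟨hyL', hy16'⟩ := mem_nbr hy'
  have hyy : y ≠ y' := fun h => hne (by rw [h])
  rw [inner_toE (by norm_num), ip_proj, hy16, hy16', ip_x0_x0, div_le_iff₀ (by norm_num)]
  have h16 : (ip y y' : ℝ) ≤ 16 := by exact_mod_cast ip_le_of_mem hyL hyL' hyy
  push_cast
  linarith

/-- The projected neighbours are orthogonal to `x₀`. -/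
theorem inner_x0_pre4600 : ∀ x ∈ pre4600, inner ℝ (toE 96 x0) x = 0 := by
  intro x hx
  obtain ⟨y, hy, rfl⟩ := mem_image.mp hx
  obtain ⟨_, hy16⟩ := mem_nbr hy
  rw [inner_toE (by norm_num), ip_x0_proj, hy16, ip_x0_x0]; norm_num

/-- `x₀ ≠ 0` in `ℝ²⁴`. -/
theorem toE_x0_ne_zero : toE 96 x0 ≠ 0 := by
  intro h
  have := congrArg (fun v : EuclideanSpace ℝ (Fin 24) => v 0) h
  simp only [toE, PiLp.toLp_apply, PiLp.zero_apply, mul_eq_zero, inv_eq_zero] at this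
  rcases this with h1 | h1
  · exact (Real.sqrt_ne_zero'.mpr (by norm_num)) h1
  · exact absurd h1 (by simp [x0, avec])

/-- **`A(23, arccos 1/3) ≥ 4600`, attained side**: `4600` unit vectors of `ℝ²³` with pairwise inner products
`≤ 1/3` (the Leech neighbours of a minimal vector). [cite: CohnKumar2006, Table 1] -/
theorem exists_code_4600 : ∃ C : Finset (EuclideanSpace ℝ (Fin 23)),
    C.card = 4600 ∧ (∀ x ∈ C, ‖x‖ = 1) ∧ (∀ x ∈ C, ∀ y ∈ C, x ≠ y → inner ℝ x y ≤ 1 / 3) := by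
  obtain ⟨C', hc, hn, hi, _⟩ := exists_transfer_orthogonal_singleton (n := 23) (toE 96 x0) toE_x0_ne_zero
    pre4600 inner_x0_pre4600
  refine ⟨C', by rw [hc, card_pre4600], fun x' hx' => ?_, fun x' hx' y' hy' hne => ?_⟩
  · obtain ⟨x, hx, he⟩ := hn x' hx'
    rw [he]; exact norm_pre4600 x hx
  · obtain ⟨x, hx, y, hy, hxy, he⟩ := hi x' hx' y' hy' hne
    rw [he]; exact inner_pre4600 x hx y hy hxy

/-- **`A(23, arccos 1/3) = 4600`**: `4600` is the greatest cardinality of a set of unit vectors of `ℝ²³` with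
pairwise inner products `≤ 1/3` (upper bound: the cell's kernel-checked sharp Delsarte certificate
`SphericalCodes.code_dim23_le_4600`; attained by the Leech neighbours). [cite: CohnKumar2006, Table 1] -/
theorem code_dim23_third_isGreatest : IsGreatest {N : ℕ | ∃ C : Finset (EuclideanSpace ℝ (Fin 23)),
    C.card = N ∧ (∀ x ∈ C, ‖x‖ = 1) ∧ (∀ x ∈ C, ∀ y ∈ C, x ≠ y → inner ℝ x y ≤ 1 / 3)} 4600 := by
  refine ⟨exists_code_4600, ?_⟩
  rintro N ⟨C, rfl, h1, h2⟩
  exact SphericalCodes.code_dim23_le_4600 C h1 h2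

end Summit.Ventures.PackingBounds.Config.Leech
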